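/-
Copyright: harness cell hodgecm-mathlib. III-11c global road (A-p13 lead), pieces (N2)/(N3).
-/
import Literature.NumberTheory.AdelicBaseChange.AdeleNormLocal
import Literature.NumberTheory.AdelicBaseChange.AdeleNormTrace
import HarnessLib

/-!
# `N_{L/K}(β) = ∏_{w ∣ v} N_{L_w/K_v}(β)` in `K_v`, and norms of local squares

Two bookkeeping facts for the III-11c «global road» (Hilbert-symbol norm compatibility at dyadic completions via
Hilbert reciprocity): for number fields `L/K`, a finite place `v` of `K` and `β ∈ L`,

* (N2) `algebraMap_adicCompletion_norm_eq_prod`: the global norm `N_{L/K} β`, embedded in `K_v`, is the product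
  over the places `w ∣ v` of `L` of the local norms `N_{L_w/K_v}(β)` — the principal-idèle case of
  [CasselsFrohlichANT1967, Ch. II §19 (19.19)] (`finiteAdeleRelNorm_apply_eq_prod` + `finiteAdeleRelNorm_algebraMap`);
* (N3) `isSquare_algebraMap_norm_of_forall_isSquare`: if `β` is a square in every `L_w`, `w ∣ v`, then `N_{L/K} β`
  is a square in `K_v` (norms are multiplicative).
-/

open scoped NumberField

namespace Literature.NumberTheory.QuadraticForms

open NumberField IsDedekindDomain IsDedekindDomain.HeightOneSpectrum Literature.NumberTheory.AdelicBaseChange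

variable (K L : Type) [Field K] [NumberField K] [Field L] [NumberField L] [Algebra K L]
variable (v : HeightOneSpectrum (𝓞 K))

/-- **(N2) `N_{L/K}(β) = ∏_{w ∣ v} N_{L_w/K_v}(β)` in `K_v`**: the global norm of `β ∈ L`, embedded in the completion
`K_v`, is the product over the places `w` of `L` above `v` of the local norms of the images of `β`
(principal-idèle case of (19.19)). [cite: CasselsFrohlichANT1967, Ch. II §19 (19.19)] -/
theorem algebraMap_adicCompletion_norm_eq_prod (β : L) :
    letI := Extension.fintype (𝓞 K) K L (𝓞 L) v
    algebraMap K (v.adicCompletion K) (Algebra.norm K β) =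
      ∏ w : v.Extension (𝓞 L), Algebra.norm (v.adicCompletion K) (algebraMap L (w.1.adicCompletion L) β) := by
  letI := Extension.fintype (𝓞 K) K L (𝓞 L) v
  have h := finiteAdeleRelNorm_apply_eq_prod K L v (algebraMap L (FiniteAdeleRing (𝓞 L) L) β)
  rw [finiteAdeleRelNorm_algebraMap, FiniteAdeleRing.algebraMap_apply_eq_algebraMap] at h
  exact h

/-- **(N3) local squares have square norm**: if `β ∈ L` is a square in `L_w` for every place `w ∣ v` of `L`, then
`N_{L/K} β` is a square in `K_v` ((N2) and multiplicativity of `N_{L_w/K_v}`).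
[cite: CasselsFrohlichANT1967, Ch. II §19 (19.19)] -/
theorem isSquare_algebraMap_norm_of_forall_isSquare (β : L)
    (h : ∀ w : v.Extension (𝓞 L), IsSquare (algebraMap L (w.1.adicCompletion L) β)) :
    IsSquare (algebraMap K (v.adicCompletion K) (Algebra.norm K β)) := by
  letI := Extension.fintype (𝓞 K) K L (𝓞 L) v
  rw [algebraMap_adicCompletion_norm_eq_prod K L v β]
  exact Finset.isSquare_prod _ fun w _ => (h w).map (Algebra.norm (v.adicCompletion K))

end Literature.NumberTheory.QuadraticForms
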